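import Literature.Analysis.FluidPDE.Tao2016AveragedNS.SplitCascadeRescaledModes
import HarnessLib

/-!
# The split Prop. 6.5: the window asymmetry certificate and the mode equations with the tree's EXACT errors

T. Tao, *Finite time blowup for an averaged three-dimensional Navier–Stokes equation*,
J. Amer. Math. Soc. **29** (2016), 601–674 = arXiv:1402.0290v3, §6.6 (6.129)–(6.137), §6.7 (6.177).
HONEST FRAMING: statements about the SPLIT cascade model system; nothing here proves the split
Prop. 6.5 and nothing here concerns the true Navier–Stokes equations.

The device by which the raw-hypotheses files of the tree's §6.7 bootstrap (`TaoCascadeZeroScalePhase`,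
`…RotorPhase`, `…CoarseSecondary`, `…CoarseEnergy`, `…DrainEnergy`) port by renaming: a WINDOW
ASYMMETRY CERTIFICATE `AsymWindow ε₀ K ε C₁ n₀ W T ζ` — the pointwise bounds `|Z̃_{i,k}(t)| ≤ ζ`,
`k ∈ {-1,0,1}`, `t ∈ [0,T]`, together with the master smallness
`16K⁵(1+ε₀)²(ε⁻² + ε⁻¹K¹⁰ + K + 1)ζ² ≤ (C₁/2)(1+ε₀)^{-n₀/2}` — under which the split mode equations of
`SplitCascadeRescaledModes.lean`, for hypotheses carried with HALF the error constant (`C₁/2`), hold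
with EXACTLY the tree's right-hand sides (`eq_a_zero'`, …, `eq_d_neg_one'`), and the two energy
inequalities with an extra `+(C₁/2)(1+ε₀)^{-n₀/2}` (`energy_zero_deriv_le'`, `energy_neg_one_deriv_le'`).
The split `ZeroScale.Context` of `SplitCascadeZeroScaleSetup.lean` carries the same pointwise clause
and the weaker master smallness without the factor `K⁵(1+ε₀)²` (enough for scales `0, 1`).

## References

* T. Tao, J. Amer. Math. Soc. 29 (2016), 601–674 = arXiv:1402.0290v3, §6.6 (6.129)–(6.137), §6.7.
  [`Tao2016AveragedNS`]
-/

noncomputable section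

open Set MeasureTheory

namespace Literature.Analysis.FluidPDE.Tao2016AveragedNS

open TaoCascade

/-- **The window asymmetry certificate** of the split bootstrap: on `[0, T]` the asymmetries of the
three live scales are bounded by `ζ`, and `ζ` is small enough that every asymmetry correction of the
reduced equations fits into `(C₁/2)(1+ε₀)^{-n₀/2}`. [cite: Tao2016AveragedNS, §6.7] -/
structure AsymWindow (ε₀ K ε C₁ : ℝ) (n₀ : ℤ) (W : Fin 3 → ℤ → ℝ → ℝ) (T ζ : ℝ) : Prop where
  /-- `|Z̃_{i,k}(t)| ≤ ζ` for `k = -1, 0, 1`, `t ∈ [0, T]`. -/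
  asym : ∀ t ∈ Icc 0 T, ∀ i : Fin 3, |W i (-1) t| ≤ ζ ∧ |W i 0 t| ≤ ζ ∧ |W i 1 t| ≤ ζ
  /-- The master smallness (the factor `K⁵(1+ε₀)²` serves the coarse scale `-1`, whose errors are
  weighted by `(1+ε₀)^{-2}√Ẽ₋₁ ≥ (1+ε₀)^{-2}K⁻⁵`). -/
  small : 16 * (K ^ 5 * (1 + ε₀) ^ (2 : ℝ)) * ((ε ^ 2)⁻¹ + ε⁻¹ * K ^ 10 + K + 1) * ζ ^ 2 ≤
    C₁ / 2 * (1 + ε₀) ^ (-(n₀ : ℝ) / 2)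

namespace AsymWindow

variable {ε₀ K ε C₁ : ℝ} {n₀ : ℤ} {W : Fin 3 → ℤ → ℝ → ℝ} {T ζ : ℝ}

/-- The individual budgets out of the master smallness (`ε ≤ 1`, `K ≥ 1`, `ε₀ ≥ 0`): the window
budgets `ε⁻²ζ², (ε + ε⁻¹K¹⁰)ζ², ζ², 8(ε⁻² + K)ζ², 14Kζ² ≤ (C₁/2)(1+ε₀)^{-n₀/2}` and the coarse budgets
`K⁵(1+ε₀)² X ζ² ≤ (C₁/2)(1+ε₀)^{-n₀/2}` for `X ∈ {ε⁻², ε + ε⁻¹K¹⁰, 1}`. [cite: Tao2016AveragedNS, §6.7] -/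
theorem budget (hw : AsymWindow ε₀ K ε C₁ n₀ W T ζ) (hε : 0 < ε) (hε1 : ε ≤ 1) (hK : 1 ≤ K)
    (hε₀ : 0 ≤ ε₀) :
    (ε ^ 2)⁻¹ * ζ ^ 2 ≤ C₁ / 2 * (1 + ε₀) ^ (-(n₀ : ℝ) / 2) ∧
    (ε + ε⁻¹ * K ^ 10) * ζ ^ 2 ≤ C₁ / 2 * (1 + ε₀) ^ (-(n₀ : ℝ) / 2) ∧
    ζ ^ 2 ≤ C₁ / 2 * (1 + ε₀) ^ (-(n₀ : ℝ) / 2) ∧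
    8 * ((ε ^ 2)⁻¹ + K) * ζ ^ 2 ≤ C₁ / 2 * (1 + ε₀) ^ (-(n₀ : ℝ) / 2) ∧
    14 * K * ζ ^ 2 ≤ C₁ / 2 * (1 + ε₀) ^ (-(n₀ : ℝ) / 2) ∧
    K ^ 5 * (1 + ε₀) ^ (2 : ℝ) * ((ε ^ 2)⁻¹ * ζ ^ 2) ≤ C₁ / 2 * (1 + ε₀) ^ (-(n₀ : ℝ) / 2) ∧
    K ^ 5 * (1 + ε₀) ^ (2 : ℝ) * ((ε + ε⁻¹ * K ^ 10) * ζ ^ 2) ≤ C₁ / 2 * (1 + ε₀) ^ (-(n₀ : ℝ) / 2) ∧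
    K ^ 5 * (1 + ε₀) ^ (2 : ℝ) * ζ ^ 2 ≤ C₁ / 2 * (1 + ε₀) ^ (-(n₀ : ℝ) / 2) := by
  have hm := hw.small
  have hK0 : 0 < K := by linarith
  have hz : 0 ≤ ζ ^ 2 := sq_nonneg _
  have hq2 : (1 : ℝ) ≤ (1 + ε₀) ^ (2 : ℝ) := Real.one_le_rpow (by linarith) (by norm_num)
  have hK5 : (1 : ℝ) ≤ K ^ 5 := one_le_pow₀ hK
  -- `L := K⁵ (1+ε₀)² ≥ 1`, `S := (ε⁻² + ε⁻¹K¹⁰ + K + 1) ζ² ≥ 0`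
  have hL : (1 : ℝ) ≤ K ^ 5 * (1 + ε₀) ^ (2 : ℝ) := one_le_mul_of_one_le_of_one_le hK5 hq2
  have hL0 : (0 : ℝ) ≤ K ^ 5 * (1 + ε₀) ^ (2 : ℝ) := by linarith
  have hS0 : 0 ≤ ((ε ^ 2)⁻¹ + ε⁻¹ * K ^ 10 + K + 1) * ζ ^ 2 := by positivity
  -- the master in the two forms `16 L S ≤ B` and `16 S ≤ B`
  have hLS : 16 * (K ^ 5 * (1 + ε₀) ^ (2 : ℝ)) * (((ε ^ 2)⁻¹ + ε⁻¹ * K ^ 10 + K + 1) * ζ ^ 2) ≤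
      C₁ / 2 * (1 + ε₀) ^ (-(n₀ : ℝ) / 2) := by
    have e : 16 * (K ^ 5 * (1 + ε₀) ^ (2 : ℝ)) * (((ε ^ 2)⁻¹ + ε⁻¹ * K ^ 10 + K + 1) * ζ ^ 2) =
        16 * (K ^ 5 * (1 + ε₀) ^ (2 : ℝ)) * ((ε ^ 2)⁻¹ + ε⁻¹ * K ^ 10 + K + 1) * ζ ^ 2 := by ring
    rw [e]; exact hm
  have hS : 16 * (((ε ^ 2)⁻¹ + ε⁻¹ * K ^ 10 + K + 1) * ζ ^ 2) ≤ C₁ / 2 * (1 + ε₀) ^ (-(n₀ : ℝ) / 2) := by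
    have : 16 * (((ε ^ 2)⁻¹ + ε⁻¹ * K ^ 10 + K + 1) * ζ ^ 2) ≤
        16 * (K ^ 5 * (1 + ε₀) ^ (2 : ℝ)) * (((ε ^ 2)⁻¹ + ε⁻¹ * K ^ 10 + K + 1) * ζ ^ 2) := by
      have h16 : 0 ≤ 16 * (((ε ^ 2)⁻¹ + ε⁻¹ * K ^ 10 + K + 1) * ζ ^ 2) := by positivity
      calc 16 * (((ε ^ 2)⁻¹ + ε⁻¹ * K ^ 10 + K + 1) * ζ ^ 2)
          = 1 * (16 * (((ε ^ 2)⁻¹ + ε⁻¹ * K ^ 10 + K + 1) * ζ ^ 2)) := (one_mul _).symm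
        _ ≤ (K ^ 5 * (1 + ε₀) ^ (2 : ℝ)) * (16 * (((ε ^ 2)⁻¹ + ε⁻¹ * K ^ 10 + K + 1) * ζ ^ 2)) :=
            mul_le_mul_of_nonneg_right hL h16
        _ = _ := by ring
    exact this.trans hLS
  -- the pieces of `S`
  have h1 : 0 ≤ (ε ^ 2)⁻¹ * ζ ^ 2 := by positivity
  have h2 : 0 ≤ ε⁻¹ * K ^ 10 * ζ ^ 2 := by positivity
  have h3 : 0 ≤ K * ζ ^ 2 := by positivity
  have h4 : ε * ζ ^ 2 ≤ ζ ^ 2 := by nlinarith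
  have eS : ((ε ^ 2)⁻¹ + ε⁻¹ * K ^ 10 + K + 1) * ζ ^ 2 =
      (ε ^ 2)⁻¹ * ζ ^ 2 + ε⁻¹ * K ^ 10 * ζ ^ 2 + K * ζ ^ 2 + ζ ^ 2 := by ring
  rw [eS] at hS hLS
  refine ⟨by linarith, by nlinarith, by linarith, by nlinarith, by linarith, ?_, ?_, ?_⟩
  · have : K ^ 5 * (1 + ε₀) ^ (2 : ℝ) * ((ε ^ 2)⁻¹ * ζ ^ 2) ≤
        K ^ 5 * (1 + ε₀) ^ (2 : ℝ) * ((ε ^ 2)⁻¹ * ζ ^ 2 + ε⁻¹ * K ^ 10 * ζ ^ 2 + K * ζ ^ 2 + ζ ^ 2) :=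
      mul_le_mul_of_nonneg_left (by linarith) hL0
    linarith
  · have : K ^ 5 * (1 + ε₀) ^ (2 : ℝ) * ((ε + ε⁻¹ * K ^ 10) * ζ ^ 2) ≤
        K ^ 5 * (1 + ε₀) ^ (2 : ℝ) * ((ε ^ 2)⁻¹ * ζ ^ 2 + ε⁻¹ * K ^ 10 * ζ ^ 2 + K * ζ ^ 2 + ζ ^ 2) :=
      mul_le_mul_of_nonneg_left (by nlinarith) hL0
    linarith
  · have : K ^ 5 * (1 + ε₀) ^ (2 : ℝ) * ζ ^ 2 ≤
        K ^ 5 * (1 + ε₀) ^ (2 : ℝ) * ((ε ^ 2)⁻¹ * ζ ^ 2 + ε⁻¹ * K ^ 10 * ζ ^ 2 + K * ζ ^ 2 + ζ ^ 2) :=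
      mul_le_mul_of_nonneg_left (by linarith) hL0
    linarith

/-- `0 ≤ ζ` when the window is non-empty. [cite: Tao2016AveragedNS, §6.7] -/
theorem ζ_nn (hw : AsymWindow ε₀ K ε C₁ n₀ W T ζ) (hT : 0 ≤ T) : 0 ≤ ζ :=
  (abs_nonneg _).trans ((hw.asym 0 ⟨le_rfl, hT⟩ 0).1)

end AsymWindow

section Window

variable {γ ε₀ K ε C₁ C₂ C₃ : ℝ} {n₀ N : ℤ} {ηp : ℤ → ℝ} {βp : ℕ → ℝ} {τ : ℤ → ℝ}
  {Y : Fin 4 → ℤ → ℝ → ℝ} {W : Fin 3 → ℤ → ℝ → ℝ} {F : ℤ → ℝ → ℝ} {T ζ : ℝ}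

/-- `x² ≤ ζ²` when `|x| ≤ ζ`. [folklore] -/
private theorem sq_le_sq_of_abs_le' {x ζ : ℝ} (hx : |x| ≤ ζ) : x ^ 2 ≤ ζ ^ 2 := by
  rw [← sq_abs x]; exact pow_le_pow_left₀ (abs_nonneg _) hx 2

/-- `(1+ε₀)^{5/2} ≤ 8` for `0 < ε₀ < 1`. [folklore] -/
private theorem q52_le_eight {ε₀ : ℝ} (hε₀ : 0 < ε₀) (hε₀1 : ε₀ < 1) :
    (1 + ε₀) ^ ((5 : ℝ) / 2) ≤ 8 := by
  calc (1 + ε₀) ^ ((5 : ℝ) / 2) ≤ (2 : ℝ) ^ ((5 : ℝ) / 2) :=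
        Real.rpow_le_rpow (by linarith) (by linarith) (by norm_num)
    _ ≤ (2 : ℝ) ^ ((3 : ℕ) : ℝ) := Real.rpow_le_rpow_of_exponent_le (by norm_num) (by norm_num)
    _ = 8 := by rw [Real.rpow_natCast]; norm_num

/-- **(6.129) on the window with the tree's exact error**: `|∂ₜã₀ + ε⁻²c̃₀d̃₀| ≤ 2ε + 2ε²e^{-K¹⁰} +
2K Em + C₁(1+ε₀)^{-n₀/2}` for `t ∈ [0,T]` with `Ẽ₀(t) ≤ 1`, `Ẽ₋₁(t) ≤ Em`, given hypotheses with error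
constant `C₁/2` and the window certificate. [cite: Tao2016AveragedNS, §6.6 (6.129)] -/
theorem RescaledSplitHypotheses.eq_a_zero'
    (h : RescaledSplitHypotheses γ ε₀ K ε (C₁ / 2) C₂ C₃ n₀ N ηp βp τ Y W F)
    (hw : AsymWindow ε₀ K ε C₁ n₀ W T ζ) (hτ0 : τ (n₀ - N) ≤ 0) (hε : 0 < ε) (hε1 : ε ≤ 1)
    (hK1 : 1 ≤ K) (hC₁ : 0 ≤ C₁) (hε₀ : 0 < ε₀) {t Em : ℝ} (ht : t ∈ Icc 0 T) (hE0 : F 0 t ≤ 1)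
    (hEm : F (-1) t ≤ Em) :
    |derivWithin (Y 0 0) (Ici (τ (n₀ - N))) t + (ε ^ 2)⁻¹ * Y 2 0 t * Y 3 0 t| ≤
      2 * ε + 2 * ε ^ 2 * Real.exp (-K ^ 10) + 2 * K * Em + C₁ * (1 + ε₀) ^ (-((n₀ : ℝ) / 2)) := by
  have h1 := h.eq_a_zero hε.le (by linarith) (by linarith) (by linarith) (hτ0.trans ht.1) hE0 hEm
    (hw.asym t ht 1).2.1 (hw.asym t ht 2).2.1
  have hb := (hw.budget hε hε1 hK1 hε₀.le).1
  rw [show (-((n₀ : ℝ) / 2)) = -(n₀ : ℝ) / 2 by ring] at h1 ⊢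
  linarith

/-- **(6.130) on the window with the tree's exact error**: `|∂ₜb̃₀ - (εã₀² - ε⁻¹K¹⁰c̃₀²)| ≤
C₁(1+ε₀)^{-n₀/2}`. [cite: Tao2016AveragedNS, §6.6 (6.130)] -/
theorem RescaledSplitHypotheses.eq_b_zero'
    (h : RescaledSplitHypotheses γ ε₀ K ε (C₁ / 2) C₂ C₃ n₀ N ηp βp τ Y W F)
    (hw : AsymWindow ε₀ K ε C₁ n₀ W T ζ) (hτ0 : τ (n₀ - N) ≤ 0) (hε : 0 < ε) (hε1 : ε ≤ 1)
    (hK1 : 1 ≤ K) (hC₁ : 0 ≤ C₁) (hε₀ : 0 < ε₀) {t : ℝ} (ht : t ∈ Icc 0 T) (hE0 : F 0 t ≤ 1) :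
    |derivWithin (Y 1 0) (Ici (τ (n₀ - N))) t - (ε * Y 0 0 t ^ 2 - ε⁻¹ * K ^ 10 * Y 2 0 t ^ 2)| ≤
      C₁ * (1 + ε₀) ^ (-((n₀ : ℝ) / 2)) := by
  have h1 := h.eq_b_zero hε.le (by linarith) (by linarith) (hτ0.trans ht.1) hE0
    (hw.asym t ht 0).2.1 (hw.asym t ht 1).2.1
  have hb := (hw.budget hε hε1 hK1 hε₀.le).2.1
  rw [show (-((n₀ : ℝ) / 2)) = -(n₀ : ℝ) / 2 by ring] at h1 ⊢
  linarith

/-- **(6.131) on the window with the tree's exact error**: `|∂ₜc̃₀ - (ε²e^{-K¹⁰}ã₀² + ε⁻¹K¹⁰b̃₀c̃₀)| ≤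
C₁(1+ε₀)^{-n₀/2}`. [cite: Tao2016AveragedNS, §6.6 (6.131)] -/
theorem RescaledSplitHypotheses.eq_c_zero'
    (h : RescaledSplitHypotheses γ ε₀ K ε (C₁ / 2) C₂ C₃ n₀ N ηp βp τ Y W F)
    (hw : AsymWindow ε₀ K ε C₁ n₀ W T ζ) (hτ0 : τ (n₀ - N) ≤ 0) (hε : 0 < ε) (hε1 : ε ≤ 1)
    (hK1 : 1 ≤ K) (hC₁ : 0 ≤ C₁) (hε₀ : 0 < ε₀) {t : ℝ} (ht : t ∈ Icc 0 T) (hE0 : F 0 t ≤ 1) :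
    |derivWithin (Y 2 0) (Ici (τ (n₀ - N))) t -
        (ε ^ 2 * Real.exp (-K ^ 10) * Y 0 0 t ^ 2 + ε⁻¹ * K ^ 10 * Y 1 0 t * Y 2 0 t)| ≤
      C₁ * (1 + ε₀) ^ (-((n₀ : ℝ) / 2)) := by
  have h1 := h.eq_c_zero (by linarith) (by linarith) (hτ0.trans ht.1) hE0 (hw.asym t ht 0).2.1
  have hb := (hw.budget hε hε1 hK1 hε₀.le).2.2.1
  have hexp : Real.exp (-K ^ 10) ≤ 1 := by
    rw [Real.exp_le_one_iff]; have := pow_nonneg (by linarith : (0 : ℝ) ≤ K) 10; linarith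
  have hz : 0 ≤ ζ ^ 2 := sq_nonneg _
  have : ε ^ 2 * Real.exp (-K ^ 10) * ζ ^ 2 ≤ ζ ^ 2 := by
    have h2 : ε ^ 2 * Real.exp (-K ^ 10) ≤ 1 := by
      calc ε ^ 2 * Real.exp (-K ^ 10) ≤ 1 ^ 2 * 1 := by gcongr
        _ = 1 := by ring
    nlinarith
  rw [show (-((n₀ : ℝ) / 2)) = -(n₀ : ℝ) / 2 by ring] at h1 ⊢
  linarith

/-- **(6.132) on the window with the tree's exact error**: `|∂ₜd̃₀ - (ε⁻²c̃₀ã₀ - (1+ε₀)^{5/2}Kd̃₀ã₁)| ≤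
C₁(1+ε₀)^{-n₀/2}`. [cite: Tao2016AveragedNS, §6.6 (6.132)] -/
theorem RescaledSplitHypotheses.eq_d_zero'
    (h : RescaledSplitHypotheses γ ε₀ K ε (C₁ / 2) C₂ C₃ n₀ N ηp βp τ Y W F)
    (hw : AsymWindow ε₀ K ε C₁ n₀ W T ζ) (hτ0 : τ (n₀ - N) ≤ 0) (hε : 0 < ε) (hε1 : ε ≤ 1)
    (hK1 : 1 ≤ K) (hC₁ : 0 ≤ C₁) (hε₀ : 0 < ε₀) {t : ℝ} (ht : t ∈ Icc 0 T) (hE0 : F 0 t ≤ 1) :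
    |derivWithin (Y 3 0) (Ici (τ (n₀ - N))) t -
        ((ε ^ 2)⁻¹ * Y 2 0 t * Y 0 0 t - (1 + ε₀) ^ ((5 : ℝ) / 2) * K * Y 3 0 t * Y 0 1 t)| ≤
      C₁ * (1 + ε₀) ^ (-((n₀ : ℝ) / 2)) := by
  have h1 := h.eq_d_zero (by linarith) (by linarith) (hτ0.trans ht.1) hE0 (hw.asym t ht 0).2.1
    (hw.asym t ht 1).2.1
  have hb := (hw.budget hε hε1 hK1 hε₀.le).1
  rw [show (-((n₀ : ℝ) / 2)) = -(n₀ : ℝ) / 2 by ring] at h1 ⊢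
  linarith

/-- **(6.133) on the window with the tree's exact error**: `|∂ₜã₁ - (1+ε₀)^{5/2}Kd̃₀²| ≤
(1+ε₀)^{5/2}(εB_b + ε²e^{-K¹⁰}B_c)|ã₁| + (1+ε₀)^{5/2}ε⁻²B_cB_d + C₁(1+ε₀)^{2-n₀/2}`.
[cite: Tao2016AveragedNS, §6.6 (6.133)] -/
theorem RescaledSplitHypotheses.eq_a_one'
    (h : RescaledSplitHypotheses γ ε₀ K ε (C₁ / 2) C₂ C₃ n₀ N ηp βp τ Y W F)
    (hw : AsymWindow ε₀ K ε C₁ n₀ W T ζ) (hτ0 : τ (n₀ - N) ≤ 0) (hε : 0 < ε) (hε1 : ε ≤ 1)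
    (hK1 : 1 ≤ K) (hC₁ : 0 ≤ C₁) (hε₀ : 0 < ε₀) (hε₀1 : ε₀ < 1) {t Bb Bc Bd : ℝ}
    (ht : t ∈ Icc 0 T) (hE1 : F 1 t ≤ 1) (hb : |Y 1 1 t| ≤ Bb) (hc : |Y 2 1 t| ≤ Bc)
    (hd : |Y 3 1 t| ≤ Bd) :
    |derivWithin (Y 0 1) (Ici (τ (n₀ - N))) t - (1 + ε₀) ^ ((5 : ℝ) / 2) * K * Y 3 0 t ^ 2| ≤
      (1 + ε₀) ^ ((5 : ℝ) / 2) * (ε * Bb + ε ^ 2 * Real.exp (-K ^ 10) * Bc) * |Y 0 1 t| +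
        ((1 + ε₀) ^ ((5 : ℝ) / 2) * (ε ^ 2)⁻¹ * Bc * Bd + C₁ * (1 + ε₀) ^ (2 - (n₀ : ℝ) / 2)) := by
  have h1 := h.eq_a_one hε (by linarith) (by linarith) (by linarith) (hτ0.trans ht.1) hE1 hb hc hd
    (hw.asym t ht 1).2.2 (hw.asym t ht 2).2.2 (hw.asym t ht 2).2.1
  have hbud := (hw.budget hε hε1 hK1 hε₀.le).2.2.2.1
  have h0 : (0 : ℝ) < 1 + ε₀ := by linarith
  have hq := q52_le_eight hε₀ hε₀1
  have hsplit : (1 + ε₀) ^ (2 - (n₀ : ℝ) / 2) = (1 + ε₀) ^ (2 : ℝ) * (1 + ε₀) ^ (-(n₀ : ℝ) / 2) := by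
    rw [← Real.rpow_add h0]; congr 1; ring
  have h2 : (1 : ℝ) ≤ (1 + ε₀) ^ (2 : ℝ) := Real.one_le_rpow (by linarith) (by norm_num)
  have hρ : 0 ≤ (1 + ε₀) ^ (-(n₀ : ℝ) / 2) := Real.rpow_nonneg h0.le _
  have hz : 0 ≤ (ε ^ 2)⁻¹ * ζ ^ 2 + K * ζ ^ 2 := by
    have : (0 : ℝ) ≤ K := by linarith
    positivity
  have h3 : (1 + ε₀) ^ ((5 : ℝ) / 2) * ((ε ^ 2)⁻¹ * ζ ^ 2 + K * ζ ^ 2) ≤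
      C₁ / 2 * (1 + ε₀) ^ (-(n₀ : ℝ) / 2) := by
    calc (1 + ε₀) ^ ((5 : ℝ) / 2) * ((ε ^ 2)⁻¹ * ζ ^ 2 + K * ζ ^ 2)
        ≤ 8 * ((ε ^ 2)⁻¹ * ζ ^ 2 + K * ζ ^ 2) := mul_le_mul_of_nonneg_right hq hz
      _ = 8 * ((ε ^ 2)⁻¹ + K) * ζ ^ 2 := by ring
      _ ≤ _ := hbud
  have h4 : C₁ / 2 * (1 + ε₀) ^ (-(n₀ : ℝ) / 2) ≤ C₁ / 2 * (1 + ε₀) ^ (2 - (n₀ : ℝ) / 2) := by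
    rw [hsplit]
    have : C₁ / 2 * (1 + ε₀) ^ (-(n₀ : ℝ) / 2) * 1 ≤
        C₁ / 2 * (1 + ε₀) ^ (-(n₀ : ℝ) / 2) * (1 + ε₀) ^ (2 : ℝ) :=
      mul_le_mul_of_nonneg_left h2 (by positivity)
    linarith
  linarith

/-- **(6.49♯) at scale `0` on the window, Tao's form up to the absorbed asymmetry**:
`∂ₜẼ₀ ≤ -(1+ε₀)^{5/2}K d̃₀²ã₁ + 2√2 K Em + (C₁/2)(1+ε₀)^{-n₀/2}` (`Ẽ₀, Ẽ₁ ≤ 1`, `Ẽ₋₁ ≤ Em`).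
[cite: Tao2016AveragedNS, §6.4 (6.49)] -/
theorem RescaledSplitHypotheses.energy_zero_deriv_le'
    (h : RescaledSplitHypotheses γ ε₀ K ε (C₁ / 2) C₂ C₃ n₀ N ηp βp τ Y W F)
    (hw : AsymWindow ε₀ K ε C₁ n₀ W T ζ) (hτ0 : τ (n₀ - N) ≤ 0) (hε : 0 < ε) (hε1 : ε ≤ 1)
    (hK1 : 1 ≤ K) (hε₀ : 0 < ε₀) (hε₀1 : ε₀ < 1) {t Em : ℝ} (ht : t ∈ Icc 0 T) (hE0 : F 0 t ≤ 1)
    (hE1 : F 1 t ≤ 1) (hEm : F (-1) t ≤ Em) :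
    derivWithin (F 0) (Ici (τ (n₀ - N))) t ≤
      -((1 + ε₀) ^ ((5 : ℝ) / 2) * K * Y 3 0 t ^ 2 * Y 0 1 t) + 2 * Real.sqrt 2 * K * Em +
        C₁ / 2 * (1 + ε₀) ^ (-(n₀ : ℝ) / 2) := by
  have hK : 0 < K := by linarith
  have h1 := h.energy_zero_deriv_le hK.le (by linarith) (hτ0.trans ht.1) hE0 hEm
    (hw.asym t ht 2).2.1
  have hbud := (hw.budget hε hε1 hK1 hε₀.le).2.2.2.2.1
  have hq := q52_le_eight hε₀ hε₀1
  have ha1 : |Y 0 1 t| ≤ 3 / 2 := by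
    have hsq := h.sq_le_two_mul_energy 0 1 (hτ0.trans ht.1)
    rw [abs_le]; constructor <;> nlinarith
  have hz : 0 ≤ ζ ^ 2 := sq_nonneg _
  have hextra : (1 + ε₀) ^ ((5 : ℝ) / 2) * K * ζ ^ 2 * |Y 0 1 t| ≤ 14 * K * ζ ^ 2 := by
    calc (1 + ε₀) ^ ((5 : ℝ) / 2) * K * ζ ^ 2 * |Y 0 1 t|
        ≤ 8 * K * ζ ^ 2 * (3 / 2) := by
          apply mul_le_mul _ ha1 (abs_nonneg _) (by positivity)
          exact mul_le_mul_of_nonneg_right (mul_le_mul_of_nonneg_right hq hK.le) hz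
      _ = 12 * K * ζ ^ 2 := by ring
      _ ≤ 14 * K * ζ ^ 2 := by nlinarith [mul_nonneg hK.le hz]
  linarith

/-- The coarse-scale error weight absorbs `ε⁻²ζ²`-type corrections when `Ẽ₋₁`'s bound is at least
`K⁻¹⁰`: `(1+ε₀)^{-5/2} X ζ² ≤ (C₁/2)(1+ε₀)^{-2-n₀/2}√E₁` for `X ∈ {ε⁻², ε + ε⁻¹K¹⁰, ε²e^{-K¹⁰}}`, `E₁ ≥ K⁻¹⁰`.
[cite: Tao2016AveragedNS, §6.7] -/
theorem AsymWindow.coarse_budget (hw : AsymWindow ε₀ K ε C₁ n₀ W T ζ) (hε : 0 < ε) (hε1 : ε ≤ 1)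
    (hK1 : 1 ≤ K) (hε₀ : 0 < ε₀) (hC₁ : 0 ≤ C₁) {E₁ : ℝ} (hE₁ : (K ^ 10)⁻¹ ≤ E₁) :
    (1 + ε₀) ^ (-((5 : ℝ) / 2)) * (ε ^ 2)⁻¹ * ζ ^ 2 ≤
        C₁ / 2 * (1 + ε₀) ^ (-2 - (n₀ : ℝ) / 2) * Real.sqrt E₁ ∧
      (1 + ε₀) ^ (-((5 : ℝ) / 2)) * (ε + ε⁻¹ * K ^ 10) * ζ ^ 2 ≤
        C₁ / 2 * (1 + ε₀) ^ (-2 - (n₀ : ℝ) / 2) * Real.sqrt E₁ ∧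
      (1 + ε₀) ^ (-((5 : ℝ) / 2)) * (ε ^ 2 * Real.exp (-K ^ 10)) * ζ ^ 2 ≤
        C₁ / 2 * (1 + ε₀) ^ (-2 - (n₀ : ℝ) / 2) * Real.sqrt E₁ := by
  obtain ⟨-, -, -, -, -, b1, b2, b3⟩ := hw.budget hε hε1 hK1 hε₀.le
  have h0 : (0 : ℝ) < 1 + ε₀ := by linarith
  have hK : 0 < K := by linarith
  have hQ1 : (1 + ε₀) ^ (-((5 : ℝ) / 2)) ≤ 1 :=
    Real.rpow_le_one_of_one_le_of_nonpos (by linarith) (by norm_num)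
  have hQ0 : 0 < (1 + ε₀) ^ (-((5 : ℝ) / 2)) := Real.rpow_pos_of_pos h0 _
  -- `√E₁ ≥ K⁻⁵` and `(1+ε₀)^{-2-n₀/2} = (1+ε₀)^{-2} (1+ε₀)^{-n₀/2}`, `(1+ε₀)^{-2} (1+ε₀)^2 = 1`
  have hsq : (K ^ 5)⁻¹ ≤ Real.sqrt E₁ := by
    have : (K ^ 5)⁻¹ = Real.sqrt ((K ^ 10)⁻¹) := by
      rw [show (K ^ 10)⁻¹ = ((K ^ 5)⁻¹) ^ 2 by rw [← inv_pow]; ring, Real.sqrt_sq (by positivity)]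
    rw [this]; exact Real.sqrt_le_sqrt hE₁
  have hsplit : (1 + ε₀) ^ (-2 - (n₀ : ℝ) / 2) = (1 + ε₀) ^ (-(2 : ℝ)) * (1 + ε₀) ^ (-(n₀ : ℝ) / 2) := by
    rw [← Real.rpow_add h0]; congr 1; ring
  have hinv : (1 + ε₀) ^ (-(2 : ℝ)) * (1 + ε₀) ^ (2 : ℝ) = 1 := by
    rw [← Real.rpow_add h0]; norm_num
  have hK5 : K ^ 5 * (K ^ 5)⁻¹ = 1 := by field_simp
  -- the generic step: if `K⁵(1+ε₀)² X ζ² ≤ (C₁/2)ρ₀` then `Q X ζ² ≤ (C₁/2)(1+ε₀)^{-2-n₀/2}√E₁`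
  have step : ∀ X : ℝ, 0 ≤ X → K ^ 5 * (1 + ε₀) ^ (2 : ℝ) * (X * ζ ^ 2) ≤
      C₁ / 2 * (1 + ε₀) ^ (-(n₀ : ℝ) / 2) →
      (1 + ε₀) ^ (-((5 : ℝ) / 2)) * X * ζ ^ 2 ≤ C₁ / 2 * (1 + ε₀) ^ (-2 - (n₀ : ℝ) / 2) * Real.sqrt E₁ := by
    intro X hX hb
    have hρ : 0 ≤ C₁ / 2 * (1 + ε₀) ^ (-(n₀ : ℝ) / 2) := by positivity
    have hq2 : 0 < (1 + ε₀) ^ (2 : ℝ) := Real.rpow_pos_of_pos h0 _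
    have hqm2 : 0 < (1 + ε₀) ^ (-(2 : ℝ)) := Real.rpow_pos_of_pos h0 _
    -- `X ζ² ≤ (C₁/2)ρ₀ / (K⁵ (1+ε₀)²) = (C₁/2)ρ₀ (1+ε₀)^{-2} K⁻⁵ ≤ (C₁/2) ρ₀ (1+ε₀)^{-2} √E₁`
    have h1 : X * ζ ^ 2 ≤ C₁ / 2 * (1 + ε₀) ^ (-(n₀ : ℝ) / 2) * ((1 + ε₀) ^ (-(2 : ℝ)) * (K ^ 5)⁻¹) := by
      have e : C₁ / 2 * (1 + ε₀) ^ (-(n₀ : ℝ) / 2) * ((1 + ε₀) ^ (-(2 : ℝ)) * (K ^ 5)⁻¹) *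
          (K ^ 5 * (1 + ε₀) ^ (2 : ℝ)) = C₁ / 2 * (1 + ε₀) ^ (-(n₀ : ℝ) / 2) := by
        calc _ = C₁ / 2 * (1 + ε₀) ^ (-(n₀ : ℝ) / 2) * (((1 + ε₀) ^ (-(2 : ℝ)) * (1 + ε₀) ^ (2 : ℝ)) *
              (K ^ 5 * (K ^ 5)⁻¹)) := by ring
          _ = _ := by rw [hinv, hK5]; ring
      have hL : 0 < K ^ 5 * (1 + ε₀) ^ (2 : ℝ) := by positivity
      rw [← e] at hb
      have := le_of_mul_le_mul_right (by linarith [hb] : X * ζ ^ 2 * (K ^ 5 * (1 + ε₀) ^ (2 : ℝ)) ≤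
        C₁ / 2 * (1 + ε₀) ^ (-(n₀ : ℝ) / 2) * ((1 + ε₀) ^ (-(2 : ℝ)) * (K ^ 5)⁻¹) *
          (K ^ 5 * (1 + ε₀) ^ (2 : ℝ))) hL
      exact this
    have h2 : C₁ / 2 * (1 + ε₀) ^ (-(n₀ : ℝ) / 2) * ((1 + ε₀) ^ (-(2 : ℝ)) * (K ^ 5)⁻¹) ≤
        C₁ / 2 * (1 + ε₀) ^ (-2 - (n₀ : ℝ) / 2) * Real.sqrt E₁ := by
      rw [hsplit]
      calc C₁ / 2 * (1 + ε₀) ^ (-(n₀ : ℝ) / 2) * ((1 + ε₀) ^ (-(2 : ℝ)) * (K ^ 5)⁻¹)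
          = C₁ / 2 * ((1 + ε₀) ^ (-(2 : ℝ)) * (1 + ε₀) ^ (-(n₀ : ℝ) / 2)) * (K ^ 5)⁻¹ := by ring
        _ ≤ C₁ / 2 * ((1 + ε₀) ^ (-(2 : ℝ)) * (1 + ε₀) ^ (-(n₀ : ℝ) / 2)) * Real.sqrt E₁ :=
            mul_le_mul_of_nonneg_left hsq (by positivity)
    have hXz : 0 ≤ X * ζ ^ 2 := by positivity
    calc (1 + ε₀) ^ (-((5 : ℝ) / 2)) * X * ζ ^ 2 = (1 + ε₀) ^ (-((5 : ℝ) / 2)) * (X * ζ ^ 2) := by ring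
      _ ≤ 1 * (X * ζ ^ 2) := mul_le_mul_of_nonneg_right hQ1 hXz
      _ = X * ζ ^ 2 := one_mul _
      _ ≤ _ := h1.trans h2
  refine ⟨step _ (by positivity) b1, step _ (by positivity) b2, step _ (by positivity) ?_⟩
  -- `ε² e^{-K¹⁰} ≤ 1`
  have hexp : Real.exp (-K ^ 10) ≤ 1 := by
    rw [Real.exp_le_one_iff]; have := pow_nonneg hK.le 10; linarith
  have h2 : ε ^ 2 * Real.exp (-K ^ 10) ≤ 1 := by
    calc ε ^ 2 * Real.exp (-K ^ 10) ≤ 1 ^ 2 * 1 := by gcongr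
      _ = 1 := by ring
  have hz : 0 ≤ ζ ^ 2 := sq_nonneg _
  have hL : 0 ≤ K ^ 5 * (1 + ε₀) ^ (2 : ℝ) := by positivity
  calc K ^ 5 * (1 + ε₀) ^ (2 : ℝ) * (ε ^ 2 * Real.exp (-K ^ 10) * ζ ^ 2)
      ≤ K ^ 5 * (1 + ε₀) ^ (2 : ℝ) * (1 * ζ ^ 2) := by
        apply mul_le_mul_of_nonneg_left _ hL
        exact mul_le_mul_of_nonneg_right h2 hz
    _ = K ^ 5 * (1 + ε₀) ^ (2 : ℝ) * ζ ^ 2 := by ring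
    _ ≤ _ := b3

/-- **(6.134) on the window with the tree's exact error** (`K⁻¹⁰ ≤ E₁`, `Ẽ₋₁ ≤ E₁`, `Ẽ₋₂ ≤ E₂`).
[cite: Tao2016AveragedNS, §6.6 (6.134)] -/
theorem RescaledSplitHypotheses.eq_a_neg_one'
    (h : RescaledSplitHypotheses γ ε₀ K ε (C₁ / 2) C₂ C₃ n₀ N ηp βp τ Y W F)
    (hw : AsymWindow ε₀ K ε C₁ n₀ W T ζ) (hτ0 : τ (n₀ - N) ≤ 0) (hε : 0 < ε) (hε1 : ε ≤ 1)
    (hK1 : 1 ≤ K) (hC₁ : 0 ≤ C₁) (hε₀ : 0 < ε₀) {t E₁ E₂ : ℝ} (ht : t ∈ Icc 0 T)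
    (hE₁K : (K ^ 10)⁻¹ ≤ E₁) (hEm : F (-1) t ≤ E₁) (hEm2 : F (-2) t ≤ E₂) :
    |derivWithin (Y 0 (-1)) (Ici (τ (n₀ - N))) t +
        (1 + ε₀) ^ (-((5 : ℝ) / 2)) * (ε ^ 2)⁻¹ * Y 2 (-1) t * Y 3 (-1) t| ≤
      (1 + ε₀) ^ (-((5 : ℝ) / 2)) * (2 * ε * E₁ + 2 * ε ^ 2 * Real.exp (-K ^ 10) * E₁ + 2 * K * E₂) +
        C₁ * (1 + ε₀) ^ (-2 - (n₀ : ℝ) / 2) * Real.sqrt E₁ := by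
  have h1 := h.eq_a_neg_one hε.le (by linarith) (by linarith) (by linarith) (hτ0.trans ht.1) hEm hEm2
    (hw.asym t ht 1).1 (hw.asym t ht 2).1
  have hb := (hw.coarse_budget hε hε1 hK1 hε₀ hC₁ hE₁K).1
  linarith

/-- **(6.135) on the window with the tree's exact error** (`K⁻¹⁰ ≤ E₁`).
[cite: Tao2016AveragedNS, §6.6 (6.135)] -/
theorem RescaledSplitHypotheses.eq_b_neg_one'
    (h : RescaledSplitHypotheses γ ε₀ K ε (C₁ / 2) C₂ C₃ n₀ N ηp βp τ Y W F)
    (hw : AsymWindow ε₀ K ε C₁ n₀ W T ζ) (hτ0 : τ (n₀ - N) ≤ 0) (hε : 0 < ε) (hε1 : ε ≤ 1)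
    (hK1 : 1 ≤ K) (hC₁ : 0 ≤ C₁) (hε₀ : 0 < ε₀) {t E₁ : ℝ} (ht : t ∈ Icc 0 T)
    (hE₁K : (K ^ 10)⁻¹ ≤ E₁) (hEm : F (-1) t ≤ E₁) :
    |derivWithin (Y 1 (-1)) (Ici (τ (n₀ - N))) t -
        (1 + ε₀) ^ (-((5 : ℝ) / 2)) * (ε * Y 0 (-1) t ^ 2 - ε⁻¹ * K ^ 10 * Y 2 (-1) t ^ 2)| ≤
      C₁ * (1 + ε₀) ^ (-2 - (n₀ : ℝ) / 2) * Real.sqrt E₁ := by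
  have h1 := h.eq_b_neg_one hε.le (by linarith) (by linarith) (hτ0.trans ht.1) hEm
    (hw.asym t ht 0).1 (hw.asym t ht 1).1
  have hb := (hw.coarse_budget hε hε1 hK1 hε₀ hC₁ hE₁K).2.1
  linarith

/-- **(6.136) on the window with the tree's exact error** (`K⁻¹⁰ ≤ E₁`).
[cite: Tao2016AveragedNS, §6.6 (6.136)] -/
theorem RescaledSplitHypotheses.eq_c_neg_one'
    (h : RescaledSplitHypotheses γ ε₀ K ε (C₁ / 2) C₂ C₃ n₀ N ηp βp τ Y W F)
    (hw : AsymWindow ε₀ K ε C₁ n₀ W T ζ) (hτ0 : τ (n₀ - N) ≤ 0) (hε : 0 < ε) (hε1 : ε ≤ 1)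
    (hK1 : 1 ≤ K) (hC₁ : 0 ≤ C₁) (hε₀ : 0 < ε₀) {t E₁ : ℝ} (ht : t ∈ Icc 0 T)
    (hE₁K : (K ^ 10)⁻¹ ≤ E₁) (hEm : F (-1) t ≤ E₁) :
    |derivWithin (Y 2 (-1)) (Ici (τ (n₀ - N))) t -
        (1 + ε₀) ^ (-((5 : ℝ) / 2)) *
          (ε ^ 2 * Real.exp (-K ^ 10) * Y 0 (-1) t ^ 2 + ε⁻¹ * K ^ 10 * Y 1 (-1) t * Y 2 (-1) t)| ≤
      C₁ * (1 + ε₀) ^ (-2 - (n₀ : ℝ) / 2) * Real.sqrt E₁ := by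
  have h1 := h.eq_c_neg_one (by linarith) (by linarith) (hτ0.trans ht.1) hEm (hw.asym t ht 0).1
  have hb := (hw.coarse_budget hε hε1 hK1 hε₀ hC₁ hE₁K).2.2
  linarith

/-- **(6.137) on the window with the tree's exact error** (`K⁻¹⁰ ≤ E₁`).
[cite: Tao2016AveragedNS, §6.6 (6.137)] -/
theorem RescaledSplitHypotheses.eq_d_neg_one'
    (h : RescaledSplitHypotheses γ ε₀ K ε (C₁ / 2) C₂ C₃ n₀ N ηp βp τ Y W F)
    (hw : AsymWindow ε₀ K ε C₁ n₀ W T ζ) (hτ0 : τ (n₀ - N) ≤ 0) (hε : 0 < ε) (hε1 : ε ≤ 1)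
    (hK1 : 1 ≤ K) (hC₁ : 0 ≤ C₁) (hε₀ : 0 < ε₀) {t E₁ : ℝ} (ht : t ∈ Icc 0 T)
    (hE₁K : (K ^ 10)⁻¹ ≤ E₁) (hEm : F (-1) t ≤ E₁) :
    |derivWithin (Y 3 (-1)) (Ici (τ (n₀ - N))) t -
        ((1 + ε₀) ^ (-((5 : ℝ) / 2)) * (ε ^ 2)⁻¹ * Y 2 (-1) t * Y 0 (-1) t -
          K * Y 3 (-1) t * Y 0 0 t)| ≤
      C₁ * (1 + ε₀) ^ (-2 - (n₀ : ℝ) / 2) * Real.sqrt E₁ := by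
  have h1 := h.eq_d_neg_one (by linarith) (by linarith) (hτ0.trans ht.1) hEm (hw.asym t ht 0).1
    (hw.asym t ht 1).1
  have hb := (hw.coarse_budget hε hε1 hK1 hε₀ hC₁ hE₁K).1
  linarith

/-- **(6.177♯) on the window, Tao's form up to the absorbed asymmetry**:
`∂ₜẼ₋₁ ≤ -K d̃₋₁² ã₀ + 2K(1+ε₀)^{-5/2} E₂ √(2E₁) + (C₁/2)(1+ε₀)^{-n₀/2}` (`Ẽ₀ ≤ 1`).
[cite: Tao2016AveragedNS, §6.7 (6.177)] -/
theorem RescaledSplitHypotheses.energy_neg_one_deriv_le'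
    (h : RescaledSplitHypotheses γ ε₀ K ε (C₁ / 2) C₂ C₃ n₀ N ηp βp τ Y W F)
    (hw : AsymWindow ε₀ K ε C₁ n₀ W T ζ) (hτ0 : τ (n₀ - N) ≤ 0) (hε : 0 < ε) (hε1 : ε ≤ 1)
    (hK1 : 1 ≤ K) (hε₀ : 0 < ε₀) {t E₁ E₂ : ℝ} (ht : t ∈ Icc 0 T) (hE0 : F 0 t ≤ 1)
    (hEm : F (-1) t ≤ E₁) (hEm2 : F (-2) t ≤ E₂) :
    derivWithin (F (-1)) (Ici (τ (n₀ - N))) t ≤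
      -(K * Y 3 (-1) t ^ 2 * Y 0 0 t) +
        2 * K * (1 + ε₀) ^ (-((5 : ℝ) / 2)) * E₂ * Real.sqrt (2 * E₁) +
        C₁ / 2 * (1 + ε₀) ^ (-(n₀ : ℝ) / 2) := by
  have hK : 0 < K := by linarith
  have h1 := h.energy_neg_one_deriv_le hK.le (by linarith) (hτ0.trans ht.1) hEm hEm2 (hw.asym t ht 2).1
  have hbud := (hw.budget hε hε1 hK1 hε₀.le).2.2.2.2.1
  have ha0 : |Y 0 0 t| ≤ 3 / 2 := by
    have hsq := h.sq_le_two_mul_energy 0 0 (hτ0.trans ht.1)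
    rw [abs_le]; constructor <;> nlinarith
  have hz : 0 ≤ ζ ^ 2 := sq_nonneg _
  have hextra : K * ζ ^ 2 * |Y 0 0 t| ≤ 14 * K * ζ ^ 2 := by
    calc K * ζ ^ 2 * |Y 0 0 t| ≤ K * ζ ^ 2 * (3 / 2) :=
          mul_le_mul_of_nonneg_left ha0 (by positivity)
      _ ≤ 14 * K * ζ ^ 2 := by nlinarith [mul_nonneg hK.le hz]
  linarith

end Window

end Literature.Analysis.FluidPDE.Tao2016AveragedNS
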